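import Summits.QuantumFields.YangMills.Theorems.ConvexGribovBodyCovarianceBoundTwistReduction
import HarnessLib

/-!
# Sketch (crux-strategist gen 1, stmt-QuantumFields-8780): typed strengthenings examined in STRATEGY-CENSUS.md §Strengthen

Nothing here is filed; these are the signatures S9/S10 of the census, elaborated so that the census quotes real Lean.
-/

set_option autoImplicit false

noncomputable section

namespace Summit.QuantumFields.YangMills.Cruxes.CovarianceBound.StrategistGen1

open scoped BigOperators Topology Classical MeasureTheory Matrix
open Filter MeasureTheory Literature.MathematicalPhysics.QuantumFieldTheory
open Summit.QuantumFields.YangMills.Cruxes.CovarianceBound.SupportWindow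
open Summit.QuantumFields.YangMills.Cruxes.CovarianceBound.TwistStiffness

variable {G : Type} [Group G] [TopologicalSpace G]

/-- `h` is a LOCAL minimiser of the slice Coulomb functional of `U` (a Gribov copy in the first Gribov region `Ω`:
lattice transversality + positive semi-definite lattice Faddeev–Popov operator), product topology on `Site → G`. -/
def IsCoulLocMin (r : LatticeRep G) (S : ℕ) (U : GaugeConfig 4 (2 * S + 1) G)
    (h : Site 4 (2 * S + 1) → G) : Prop :=
  IsLocalMin (coulombF r S U) h

/-- The covariance integrand with the sup taken over ALL Gribov copies (local minimisers) instead of the fundamental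
modular region. -/
def supCovOmega (r : LatticeRep G) (S : ℕ) (p : Fin 3 → ZMod (2 * S + 1))
    (U : GaugeConfig 4 (2 * S + 1) G) : ℝ :=
  ⨆ h : {h : Site 4 (2 * S + 1) → G // IsCoulLocMin r S U h}, modeCov r S U h.1 p

/-- **S9 `AllCopiesBound`** (strengthening S⁺_Ω of the census): the crux with the fundamental modular region replaced by
the whole first Gribov region. `≥` crux (absolute minimisers are local minimisers). Census verdict: refutable for
representations whose character `Re tr r(·)` has a non-identity local maximum (metastable sheets), same wall otherwise. -/
def AllCopiesBound : Prop :=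
  ∀ (G : Type) [Group G] [TopologicalSpace G] [IsTopologicalGroup G] [CompactSpace G]
    [MeasurableSpace G] [BorelSpace G], IsCompactSimpleLieGroup G → ∀ r : LatticeRep G,
    ∃ β₀ : ℝ, ∀ β : ℝ, β₀ ≤ β → ∃ D : ℝ, 0 < D ∧ ∃ S₀ : ℕ, ∀ S : ℕ, S₀ ≤ S →
      ∀ p : Fin 3 → ZMod (2 * S + 1), ∫ U, supCovOmega r S p U ∂(wilson4 r β S) ≤ D

/-- Absolute minimisers are local minimisers. -/
theorem isCoulLocMin_of_isCoulMin (r : LatticeRep G) (S : ℕ) (U : GaugeConfig 4 (2 * S + 1) G)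
    (h : Site 4 (2 * S + 1) → G) (hh : IsCoulMin r S U h) : IsCoulLocMin r S U h :=
  Filter.Eventually.of_forall fun h' => hh h'

/-- The `ε`-rewarded minimum `min_h (coul(U,h) − ε·cov(U,h,p))` (Danskin / Feynman–Hellmann dual of the integrand). -/
def rewardedMin (r : LatticeRep G) (S : ℕ) (p : Fin 3 → ZMod (2 * S + 1)) (ε : ℝ)
    (U : GaugeConfig 4 (2 * S + 1) G) : ℝ :=
  ⨅ h : Site 4 (2 * S + 1) → G, (coulombF r S U h - ε * modeCov r S U h p)

/-- **S10 `RewardGainBound ε`**: the mean GAIN from rewarding the `p`-mode at strength `ε > 0` is `≤ ε D` uniformly in the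
volume. By concavity of `ε ↦ rewardedMin` the chord slope dominates the left derivative `sup_{argmin} cov`, so for every
fixed `ε > 0` this implies the crux with constant `D`; it is a near-minimiser (shell) strengthening — census verdict S10. -/
def RewardGainBound (ε : ℝ) : Prop :=
  ∀ (G : Type) [Group G] [TopologicalSpace G] [IsTopologicalGroup G] [CompactSpace G]
    [MeasurableSpace G] [BorelSpace G], IsCompactSimpleLieGroup G → ∀ r : LatticeRep G,
    ∃ β₀ : ℝ, ∀ β : ℝ, β₀ ≤ β → ∃ D : ℝ, 0 < D ∧ ∃ S₀ : ℕ, ∀ S : ℕ, S₀ ≤ S →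
      ∀ p : Fin 3 → ZMod (2 * S + 1),
        ∫ U, (perMin r S U - rewardedMin r S p ε U) ∂(wilson4 r β S) ≤ ε * D

end Summit.QuantumFields.YangMills.Cruxes.CovarianceBound.StrategistGen1

end
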